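import Summits.AtomisticToContinuum.FouriersLaw.Theses.HoelderEscapeProfile
import Summits.AtomisticToContinuum.FouriersLaw.Theorems.HoelderEscapeProfileLocalEnergyHalfHoelderStubPulseBounded
import Summits.AtomisticToContinuum.FouriersLaw.Theorems.HoelderEscapeProfileAbelSpreadCeilingCanonicalTwin
import Summits.AtomisticToContinuum.FouriersLaw.Theorems.HoelderEscapeProfileFibreCalculusStubWeightedClusteringTransfer
import Summits.AtomisticToContinuum.FouriersLaw.Theorems.HoelderEscapeProfileFibreCalculusStubPolynomialHorizonCone
import Summits.AtomisticToContinuum.FouriersLaw.Theorems.EmbeddedDrudeMourreMourreDissolutionGibbsMixing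
import Literature.MathematicalPhysics.KineticTheory.InfiniteChainShiftInvariantUniqueness
import Literature.MathematicalPhysics.KineticTheory.InfiniteChainEnergyDensityMoments
import Literature.MathematicalPhysics.KineticTheory.InfiniteChainGoodSetSymmetries
import Literature.MathematicalPhysics.KineticTheory.InfiniteChainGeneratorLipschitz
import Literature.MathematicalPhysics.KineticTheory.InfiniteChainCovarianceMixingBox
import Literature.MathematicalPhysics.KineticTheory.InfiniteChainL2LocalityTools
import Literature.MathematicalPhysics.KineticTheory.TransportRegularityOfMixing
import Literature.MathematicalPhysics.KineticTheory.ZeroWavenumberDataOfClustering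
import Literature.MathematicalPhysics.KineticTheory.ZeroWavenumberSpace
import HarnessLib

/-!
# Stub `stub_pulseMomentGuard` of line `Sketch` (crux `HoelderEscapeProfile.LocalEnergyHalfHoelder`, stmt-AtomisticToContinuum-16008):
# the equilibrium energy pulse `S(x,t) = Cov_μ(h₀, hₓ∘φ_t)` has a finite second spatial moment at every time,
# for EVERY admissible dynamics

`--supports stmt-AtomisticToContinuum-16008` (lead `prover-line-stmt-AtomisticToContinuum-16008-0`). For the guarded
infinite pinned chain `pinnedChain ω₂ lam β γ` (`ω₂, lam, β > 0`), the shift- and momentum-reversal-invariant DLR state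
`μ` at `T > 0`, ANY `μ`-preserving dynamics `D` and the split-bond site energy `h = energyDensityZ`, the pulse
`S x t = ∫ (h₀ − m)(hₓ∘φ_t − m) dμ` (`m = ∫ h₀ dμ`) satisfies `Σₓ (1 + x²) |S(x,t)| < ∞` at every `t` — verbatim the
summability guard that crux `CoercivePulse.LinearSpread` (stmt-AtomisticToContinuum-15382) carries as a hypothesis.

Proof — an assembly of tree theorems, no new analysis:
* (∀-`D` bridge) `AbelSpreadCeiling.RegularityCollapse.stub_canonicalTwin`: every `μ`-preserving dynamics agrees
  `μ`-a.e., at every time, with a CANONICAL twin `D'` (carrier `bmGood`, measurable flow maps, identity off `bmGood`,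
  `μ`-preserving); `S` is blind to the a.e. modification (`integral_congr_ae`).
* (M) uniqueness of the shift-invariant DLR state (`eq_of_isChainGibbsMeasure_of_isShiftInvariant_pinnedChain`)
  identifies `μ` with the exponentially ρ-mixing transfer-operator state of
  `MourreDissolution.exists_gibbsState_mixing_pinnedChain`.
* (L) the polynomial-horizon weighted `L²` light cone of the canonical dynamics,
  `FibreCalculusSketch.stub_polynomialHorizonCone` (instance of `InfiniteChainDynamics.exists_weighted_l2_locality`,
  Buttà–Marchioro 2016 §3), fed with the polynomial Lipschitz modulus of `h₀` (`exists_polyLipschitz_energyDensityZ`)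
  and its moments (`memLp_energyDensityZ_pinnedChain`): a rate `ε ≥ 0`, `Σₙ (1+n)² εₙ < ∞`, controlling the `L²(μ)`
  distance of `h₀∘φ_t` to `[−n−1, n+1]`-local observables.
* (M) + (L) ⇒ `FibreCalculusSketch.stub_weightedClusteringTransfer`: a majorant `F`, `Σₓ (1+x²) F x < ∞`, of
  `|Cov_μ(h₀, (h₀∘φ_t)∘τₓ)|`; and `Cov_μ(h₀, (h₀∘φ_t)∘τₓ) = S x t` because the canonical flow commutes with the
  translations everywhere (`flow_chainShift_of_eq_id`), `h₀∘τₓ = hₓ` (`energyDensityZ_chainShift`) and `φ_t`, `τₓ`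
  preserve `μ` (`integral_comp_eq_of_measurePreserving` of the sibling stub file `…StubPulseBounded`).
No definitions, no named facts, no sorry.
-/

noncomputable section

open MeasureTheory

namespace Summit.AtomisticToContinuum.FouriersLaw.Theorems.LocalEnergyHalfHoelder.NashDoubling

open ProbabilityTheory Set Function
open Literature.MathematicalPhysics.KineticTheory.HeatConduction

/-- **Weighted space–time clustering of the energy pulse along a CANONICAL dynamics.** For the pinned chain
`pinnedChain ω₂ lam β γ` (`ω₂, lam, β > 0`), the shift-invariant DLR state `μ` at `T > 0` and a dynamics `D` with
carrier `bmGood`, measurable flow maps, identity off `bmGood`, preserving `μ`: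
`Σₓ (1+x²) |∫ (h₀ − m)(hₓ∘φ_t − m) dμ| < ∞` at every `t` (`h = energyDensityZ`, `m = ∫ h₀ dμ`) — exponential ρ-mixing
of the (unique) shift-invariant DLR state + the polynomial-horizon weighted `L²` light cone + the weighted clustering
transfer. [cite: ButtaMarchioro2016, §2 Thm 2.1–2.2 and §3] -/
theorem pmg_summable_weighted_pulse_canonical {ω₂ lam β γ : ℝ} (hω : 0 < ω₂) (hl : 0 < lam) (hβ : 0 < β)
    {T : ℝ} (hT : 0 < T) {μ : Measure ChainConfig} (hG : (pinnedChain ω₂ lam β γ).IsChainGibbsMeasure T μ)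
    (hSI : IsShiftInvariant μ) (D : InfiniteChainDynamics (pinnedChain ω₂ lam β γ))
    (hcar : D.carrier = (pinnedChain ω₂ lam β γ).bmGood) (hmeas : ∀ t : ℝ, Measurable (D.flow t))
    (hid : ∀ t : ℝ, ∀ σ ∉ (pinnedChain ω₂ lam β γ).bmGood, D.flow t σ = σ) (hP : D.PreservesMeasure μ)
    (t : ℝ) :
    Summable fun x : ℤ => (1 + (x : ℝ) ^ 2) *
      |∫ σ, ((pinnedChain ω₂ lam β γ).energyDensityZ σ 0 -
            ∫ σ', (pinnedChain ω₂ lam β γ).energyDensityZ σ' 0 ∂μ) *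
          ((pinnedChain ω₂ lam β γ).energyDensityZ (D.flow t σ) x -
            ∫ σ', (pinnedChain ω₂ lam β γ).energyDensityZ σ' 0 ∂μ) ∂μ| := by
  -- (M): the given shift-invariant DLR state IS the exponentially mixing transfer-operator state (uniqueness)
  obtain ⟨μ', hG', hS', hss', -, C, m, hm, hmix⟩ :=
    Summit.AtomisticToContinuum.FouriersLaw.Theorems.MourreDissolution.exists_gibbsState_mixing_pinnedChain
      ω₂ lam β γ hω hl.le hβ.le T hT
  have hμμ' : μ = μ' :=
    OscillatorChain.eq_of_isChainGibbsMeasure_of_isShiftInvariant_pinnedChain γ hω hl.le hβ.le hT hG hSI hG' hS'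
  subst hμμ'
  have hss : (pinnedChain ω₂ lam β γ).HasSuperstabilityEstimate μ := hss'
  haveI : IsProbabilityMeasure μ := hss.1
  have hτ : ∀ x : ℤ, MeasurePreserving (chainShift x) μ μ := hSI.measurePreserving_chainShift
  -- the chain data
  have hU1 : OscillatorChain.IsEvenPolyOfDegree (pinnedChain ω₂ lam β γ).U 2 :=
    OscillatorChain.pinnedChain_isEvenPolyOfDegree_U β γ hω.le hl
  have hV1 : OscillatorChain.IsEvenPolyOfDegree (pinnedChain ω₂ lam β γ).V 2 :=
    OscillatorChain.pinnedChain_isEvenPolyOfDegree_V ω₂ lam γ hβ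
  have hU0 : ∀ r, 0 ≤ (pinnedChain ω₂ lam β γ).U r := OscillatorChain.pinnedChain_U_nonneg β γ hω.le hl.le
  have hV0 : ∀ r, 0 ≤ (pinnedChain ω₂ lam β γ).V r := OscillatorChain.pinnedChain_V_nonneg ω₂ lam γ hβ.le
  have hUm : Measurable (pinnedChain ω₂ lam β γ).U := OscillatorChain.measurable_pinnedChain_U ω₂ lam β γ
  have hVm : Measurable (pinnedChain ω₂ lam β γ).V := OscillatorChain.measurable_pinnedChain_V ω₂ lam β γ
  -- the local observable `h₀`: measurable, reads the sites `-1, 0, 1`, in `L²` and `L⁴`, polynomially Lipschitz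
  have hxm : ∀ x : ℤ, Measurable fun σ : ChainConfig => (pinnedChain ω₂ lam β γ).energyDensityZ σ x :=
    fun x => OscillatorChain.measurable_energyDensityZ _ hUm hVm x
  have ham : Measurable fun σ : ChainConfig => (pinnedChain ω₂ lam β γ).energyDensityZ σ 0 := hxm 0
  have had : DependsOn (fun σ : ChainConfig => (pinnedChain ω₂ lam β γ).energyDensityZ σ 0) (Set.Icc (-1 : ℤ) 1) :=
    OscillatorChain.dependsOn_energyDensityZ_zero _
  have hadR : DependsOn (fun σ : ChainConfig => (pinnedChain ω₂ lam β γ).energyDensityZ σ 0)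
      (Set.Icc (-((1 : ℕ) : ℤ)) ((1 : ℕ) : ℤ)) := by
    rw [Nat.cast_one]
    exact had
  have ha2 : MemLp (fun σ : ChainConfig => (pinnedChain ω₂ lam β γ).energyDensityZ σ 0) 2 μ :=
    OscillatorChain.memLp_energyDensityZ_pinnedChain γ hω.le hl.le hβ.le hss 0 (by norm_num)
  have ha4' : MemLp (fun σ : ChainConfig => (pinnedChain ω₂ lam β γ).energyDensityZ σ 0) 4 μ :=
    OscillatorChain.memLp_energyDensityZ_pinnedChain γ hω.le hl.le hβ.le hss 0 (by norm_num)
  have ha4 : Integrable (fun σ : ChainConfig => (pinnedChain ω₂ lam β γ).energyDensityZ σ 0 ^ 4) μ := by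
    have h := ha4'.integrable_norm_pow' (p := 4)
    refine h.congr (Filter.Eventually.of_forall fun σ => ?_)
    simp only [Real.norm_eq_abs]
    exact Even.pow_abs (by decide) _
  obtain ⟨Ca, hCa, hLip⟩ := OscillatorChain.exists_polyLipschitz_energyDensityZ hU1 hV1
  -- (L): the polynomial-horizon weighted `L²` light cone of the canonical dynamics, at the window `|t|`
  obtain ⟨A, mA, hcone⟩ :=
    Summit.AtomisticToContinuum.FouriersLaw.Theorems.FibreCalculusSketch.stub_polynomialHorizonCone
      ω₂ lam β γ hω hl hβ T hT μ hG hSI D hcar hmeas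
      (fun σ : ChainConfig => (pinnedChain ω₂ lam β γ).energyDensityZ σ 0) ham had ha2 ha4
      Ca (2 * 2 + 2 * 2 + 1) hCa hLip
  obtain ⟨ε, hε0, hεs, -, happ⟩ := hcone |t| (abs_nonneg t)
  -- (M) + (L): the weighted clustering transfer
  obtain ⟨B, hB⟩ :=
    Summit.AtomisticToContinuum.FouriersLaw.Theorems.FibreCalculusSketch.stub_weightedClusteringTransfer
      μ inferInstance C m hm hmix hτ
      (fun σ : ChainConfig => (pinnedChain ω₂ lam β γ).energyDensityZ σ 0) 1 hadR ham ha2 1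
      (Real.sqrt (∫ σ, (pinnedChain ω₂ lam β γ).energyDensityZ σ 0 ^ 2 ∂μ)) (Real.sqrt_nonneg _)
  obtain ⟨F, hFs, -, hFb⟩ := hB ε hε0 hεs
  -- the evolved observable `h₀ ∘ φ_t`: measurable, in `L²` with the same norm, `L²`-local at rate `ε`
  have hgm : Measurable fun σ : ChainConfig => (pinnedChain ω₂ lam β γ).energyDensityZ (D.flow t σ) 0 :=
    ham.comp (hmeas t)
  have hg2 : MemLp (fun σ : ChainConfig => (pinnedChain ω₂ lam β γ).energyDensityZ (D.flow t σ) 0) 2 μ :=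
    ha2.comp_measurePreserving (hP.2 t)
  have hgG : Real.sqrt (∫ σ, (pinnedChain ω₂ lam β γ).energyDensityZ (D.flow t σ) 0 ^ 2 ∂μ) ≤
      Real.sqrt (∫ σ, (pinnedChain ω₂ lam β γ).energyDensityZ σ 0 ^ 2 ∂μ) :=
    Real.sqrt_le_sqrt (integral_sq_comp_eq' (hP.2 t) ham).le
  have hloc : ∀ n : ℕ, ∃ g : ChainConfig → ℝ, DependsOn g (Set.Icc (-((n + 1 : ℕ) : ℤ)) (n + 1 : ℕ)) ∧
      Measurable g ∧ MemLp g 2 μ ∧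
      Real.sqrt (∫ σ, ((pinnedChain ω₂ lam β γ).energyDensityZ (D.flow t σ) 0 - g σ) ^ 2 ∂μ) ≤ ε n := by
    intro n
    obtain ⟨g, hgd, hgm', hg2', hge⟩ := happ t le_rfl n
    refine ⟨g, hgd.mono fun i hi => ?_, hgm', hg2', hge⟩
    simp only [Set.mem_Icc, Nat.cast_add, Nat.cast_one] at hi ⊢
    constructor <;> omega
  have hbound : ∀ x : ℤ,
      |cov[fun σ : ChainConfig => (pinnedChain ω₂ lam β γ).energyDensityZ σ 0,
        (fun σ : ChainConfig => (pinnedChain ω₂ lam β γ).energyDensityZ (D.flow t σ) 0) ∘ chainShift x; μ]| ≤ F x :=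
    hFb _ hgm hg2 hgG hloc
  -- compare termwise: `Cov_μ(h₀, (h₀∘φ_t)∘τₓ) = S x t`
  refine Summable.of_nonneg_of_le (fun x => mul_nonneg (by positivity) (abs_nonneg _)) (fun x => ?_) hFs
  have hflow : ∀ σ : ChainConfig, D.flow t (chainShift x σ) = chainShift x (D.flow t σ) := fun σ =>
    D.flow_chainShift_of_eq_id hcar hid hU0 hV0 t x σ
  have hmean_x : ∫ σ, (pinnedChain ω₂ lam β γ).energyDensityZ (D.flow t σ) x ∂μ =
      ∫ σ, (pinnedChain ω₂ lam β γ).energyDensityZ σ 0 ∂μ := by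
    have h1 : ∫ σ, (pinnedChain ω₂ lam β γ).energyDensityZ (D.flow t σ) x ∂μ =
        ∫ σ, (pinnedChain ω₂ lam β γ).energyDensityZ σ x ∂μ :=
      integral_comp_eq_of_measurePreserving (hP.2 t) (hxm x)
    have h2 : ∫ σ, (pinnedChain ω₂ lam β γ).energyDensityZ (chainShift x σ) 0 ∂μ =
        ∫ σ, (pinnedChain ω₂ lam β γ).energyDensityZ σ 0 ∂μ :=
      integral_comp_chainShift (hτ x) (F := fun σ => (pinnedChain ω₂ lam β γ).energyDensityZ σ 0)
        ham.aestronglyMeasurable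
    rw [h1, ← h2]
    refine integral_congr_ae (Filter.Eventually.of_forall fun σ => ?_)
    simp only [OscillatorChain.energyDensityZ_chainShift, zero_add]
  have hcov : cov[fun σ : ChainConfig => (pinnedChain ω₂ lam β γ).energyDensityZ σ 0,
      (fun σ : ChainConfig => (pinnedChain ω₂ lam β γ).energyDensityZ (D.flow t σ) 0) ∘ chainShift x; μ] =
      ∫ σ, ((pinnedChain ω₂ lam β γ).energyDensityZ σ 0 -
            ∫ σ', (pinnedChain ω₂ lam β γ).energyDensityZ σ' 0 ∂μ) *
          ((pinnedChain ω₂ lam β γ).energyDensityZ (D.flow t σ) x -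
            ∫ σ', (pinnedChain ω₂ lam β γ).energyDensityZ σ' 0 ∂μ) ∂μ := by
    simp only [covariance, Function.comp_apply, hflow, OscillatorChain.energyDensityZ_chainShift, zero_add]
    rw [hmean_x]
  have hb := hbound x
  rw [hcov] at hb
  exact mul_le_mul_of_nonneg_left hb (by positivity)

/-- **The pulse moment guard for EVERY admissible dynamics** (the content of stub `stub_pulseMomentGuard`): for the
pinned chain (`ω₂, lam, β > 0`), the shift- and momentum-reversal-invariant DLR state `μ` at `T > 0` and ANY
`μ`-preserving dynamics `D`, `Σₓ (1+x²) |∫ (h₀ − m)(hₓ∘φ_t − m) dμ| < ∞` at every `t` — transferred from the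
canonical twin (`stub_canonicalTwin`) along the a.e. equality of the flows. [folklore] -/
theorem pmg_summable_weighted_pulse {ω₂ lam β γ : ℝ} (hω : 0 < ω₂) (hl : 0 < lam) (hβ : 0 < β)
    {T : ℝ} (hT : 0 < T) {μ : Measure ChainConfig} (hG : (pinnedChain ω₂ lam β γ).IsChainGibbsMeasure T μ)
    (hSI : IsShiftInvariant μ) (hR : μ.map (fun σ : ChainConfig => fun x : ℤ => ((σ x).1, -(σ x).2)) = μ)
    (D : InfiniteChainDynamics (pinnedChain ω₂ lam β γ)) (hP : D.PreservesMeasure μ) (t : ℝ) :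
    Summable fun x : ℤ => (1 + (x : ℝ) ^ 2) *
      |∫ σ, ((pinnedChain ω₂ lam β γ).energyDensityZ σ 0 -
            ∫ σ', (pinnedChain ω₂ lam β γ).energyDensityZ σ' 0 ∂μ) *
          ((pinnedChain ω₂ lam β γ).energyDensityZ (D.flow t σ) x -
            ∫ σ', (pinnedChain ω₂ lam β γ).energyDensityZ σ' 0 ∂μ) ∂μ| := by
  obtain ⟨D', hcar', hmeas', hid', hP', hae, -, -⟩ :=
    Summit.AtomisticToContinuum.FouriersLaw.Theorems.AbelSpreadCeiling.RegularityCollapse.stub_canonicalTwin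
      ω₂ lam β γ hω hl hβ T hT μ hG hSI hR D hP
  refine (pmg_summable_weighted_pulse_canonical hω hl hβ hT hG hSI D' hcar' hmeas' hid' hP' t).congr
    fun x => ?_
  congr 2
  refine integral_congr_ae ?_
  filter_upwards [hae t] with σ hσ
  rw [hσ]

/-- **Stub `stub_pulseMomentGuard`** (registered stub of line `Sketch`, crux `LocalEnergyHalfHoelder`, stmt-16008),
signature spelled out: under the crux hypotheses verbatim, the equilibrium energy pulse
`S x t = ∫ (h₀ − m)(hₓ∘φ_t − m) dμ` of the guarded pinned chain has a finite second spatial moment at every time,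
`Σₓ (1+x²)|S(x,t)| < ∞`, for every admissible dynamics `D`. [folklore] -/
theorem pulseMomentGuard : ∀ ω₂ lam β γ : ℝ, 0 < ω₂ → 0 < lam → 0 < β → ∀ T : ℝ, 0 < T → ∀ μ : MeasureTheory.Measure Literature.MathematicalPhysics.KineticTheory.HeatConduction.ChainConfig, (Literature.MathematicalPhysics.KineticTheory.HeatConduction.pinnedChain ω₂ lam β γ).IsChainGibbsMeasure T μ → Literature.MathematicalPhysics.KineticTheory.HeatConduction.IsShiftInvariant μ → μ.map (fun σ : Literature.MathematicalPhysics.KineticTheory.HeatConduction.ChainConfig => fun x : ℤ => ((σ x).1, -(σ x).2)) = μ → ∀ D : Literature.MathematicalPhysics.KineticTheory.HeatConduction.InfiniteChainDynamics (Literature.MathematicalPhysics.KineticTheory.HeatConduction.pinnedChain ω₂ lam β γ), D.PreservesMeasure μ → (∀ t : ℝ, ∀ᵐ σ ∂μ, D.flow t (Literature.MathematicalPhysics.KineticTheory.HeatConduction.shift σ) = Literature.MathematicalPhysics.KineticTheory.HeatConduction.shift (D.flow t σ)) → ∀ h : Literature.MathematicalPhysics.KineticTheory.HeatConduction.ChainConfig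 → ℤ → ℝ, h = (fun (σ : Literature.MathematicalPhysics.KineticTheory.HeatConduction.ChainConfig) (x : ℤ) => (σ x).2 ^ 2 / 2 + (Literature.MathematicalPhysics.KineticTheory.HeatConduction.pinnedChain ω₂ lam β γ).U (σ x).1 + ((Literature.MathematicalPhysics.KineticTheory.HeatConduction.pinnedChain ω₂ lam β γ).V ((σ (x + 1)).1 - (σ x).1) + (Literature.MathematicalPhysics.KineticTheory.HeatConduction.pinnedChain ω₂ lam β γ).V ((σ x).1 - (σ (x - 1)).1)) / 2) → ∀ S : ℤ → ℝ → ℝ, S = (fun (x : ℤ) (t : ℝ) => ∫ σ, (h σ 0 - ∫ σ', h σ' 0 ∂μ) * (h (D.flow t σ) x - ∫ σ', h σ' 0 ∂μ) ∂μ) → (∀ ν : ℝ, 0 < ν → MeasureTheory.IntegrableOn (fun t : ℝ => Real.exp (-(ν * t)) * S 0 t) (Set.Ioi 0)) → ∀ t : ℝ, Summable (fun x : ℤ => (1 + (x : ℝ) ^ 2) * |S x t|) := by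
  intro ω₂ lam β γ hω hl hβ T hT μ hG hSI hR D hP _hShift h hh S hS _hInt t
  -- `h` is literally the energy density `energyDensityZ` of the pinned chain
  obtain rfl : h = fun σ x => (pinnedChain ω₂ lam β γ).energyDensityZ σ x := hh
  subst hS
  exact pmg_summable_weighted_pulse hω hl hβ hT hG hSI hR D hP t

/-! ## The registered statement and the registered stub -/

/-- **stub `stub_pulseMomentGuard` (infrastructure; size L — fixed-time light cone + Gibbs clustering, for EVERY admissible `D`).** The pulse has a summable second moment at every time: `Σₓ (1+x²)|S(x,t)| < ∞`. VERBATIM the summability guard that route CoercivePulse's crux `LinearSpread` (stmt-AtomisticToContinuum-15382) carries as a HYPOTHESIS; K1 has no such guard, so this line must prove it. In tree for the canonical Buttà–Marchioro pair (light cone `InfiniteChainLightCone`, `L²`-locality `InfiniteChainL2Locality`, clustering `InfiniteChainClusteringTransfer`/`InfiniteChainCovarianceMixingBox`); the `∀ D` form needs the a.e. uniqueness bridge (`InfiniteChainUniqueness`). -/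
abbrev Stmt.stub_pulseMomentGuard : Prop :=
    ∀ ω₂ lam β γ : ℝ, 0 < ω₂ → 0 < lam → 0 < β → ∀ T : ℝ, 0 < T → ∀ μ : MeasureTheory.Measure Literature.MathematicalPhysics.KineticTheory.HeatConduction.ChainConfig, (Literature.MathematicalPhysics.KineticTheory.HeatConduction.pinnedChain ω₂ lam β γ).IsChainGibbsMeasure T μ → Literature.MathematicalPhysics.KineticTheory.HeatConduction.IsShiftInvariant μ → μ.map (fun σ : Literature.MathematicalPhysics.KineticTheory.HeatConduction.ChainConfig => fun x : ℤ => ((σ x).1, -(σ x).2)) = μ → ∀ D : Literature.MathematicalPhysics.KineticTheory.HeatConduction.InfiniteChainDynamics (Literature.MathematicalPhysics.KineticTheory.HeatConduction.pinnedChain ω₂ lam β γ), D.PreservesMeasure μ → (∀ t : ℝ, ∀ᵐ σ ∂μ, D.flow t (Literature.MathematicalPhysics.KineticTheory.HeatConduction.shift σ) = Literature.MathematicalPhysics.KineticTheory.HeatConduction.shift (D.flow t σ)) → ∀ h : Literature.MathematicalPhysics.KineticTheory.HeatConduction.ChainConfig → ℤ → ℝ, h = (fun (σ : Literature.MathematicalPhysics.KineticTheory.HeatConduction.ChainConfig)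 (x : ℤ) => (σ x).2 ^ 2 / 2 + (Literature.MathematicalPhysics.KineticTheory.HeatConduction.pinnedChain ω₂ lam β γ).U (σ x).1 + ((Literature.MathematicalPhysics.KineticTheory.HeatConduction.pinnedChain ω₂ lam β γ).V ((σ (x + 1)).1 - (σ x).1) + (Literature.MathematicalPhysics.KineticTheory.HeatConduction.pinnedChain ω₂ lam β γ).V ((σ x).1 - (σ (x - 1)).1)) / 2) → ∀ S : ℤ → ℝ → ℝ, S = (fun (x : ℤ) (t : ℝ) => ∫ σ, (h σ 0 - ∫ σ', h σ' 0 ∂μ) * (h (D.flow t σ) x - ∫ σ', h σ' 0 ∂μ) ∂μ) → (∀ ν : ℝ, 0 < ν → MeasureTheory.IntegrableOn (fun t : ℝ => Real.exp (-(ν * t)) * S 0 t) (Set.Ioi 0)) → ∀ t : ℝ, Summable (fun x : ℤ => (1 + (x : ℝ) ^ 2) * |S x t|)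

/-- **Registered stub `stub_pulseMomentGuard`** (type `Stmt.stub_pulseMomentGuard`, verbatim the skeleton's): the pulse of
the guarded pinned chain has a summable second spatial moment at every time, for every admissible dynamics
(`pulseMomentGuard`). [folklore] -/
theorem stub_pulseMomentGuard : Stmt.stub_pulseMomentGuard :=
  pulseMomentGuard

end Summit.AtomisticToContinuum.FouriersLaw.Theorems.LocalEnergyHalfHoelder.NashDoubling

end
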